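import Literature.NumberTheory.EllipticCurves.ProfiniteGroupDistribution
import Literature.NumberTheory.EllipticCurves.PAdicDistributionIntegral
import HarnessLib

/-!
# Bounded distributions on a group along a subgroup tower, II: reindexing, the twist `h · μ` by a
# continuous function, the push-forward to a profinite tower, and tower-continuity from topology
# (de Shalit 1987, I.3.1, I.3.4, II.4.16 (49))

Sequel of `ProfiniteGroupDistribution.lean` (de Shalit's `Λ(G, 𝒪)`-currency: `GroupDistribution 𝒰 𝕜`,
level data on the cosets `G ⧸ U n` of a tower `𝒰` of finite-index subgroups, and the Riemann integral
of tower-continuous functions). The three operations by which de Shalit's two-variable `p`-adic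
`L`-function `L_{p,𝔣}(λρ) = ∫_{𝒢(𝔣)} (λρ)^⁻¹ dμ(𝔣)` (II.4.16 (49)) is read as a measure on the
`ℤ_p²`-quotient `Gal(K̃_∞/K)` of `𝒢(𝔣) = Gal(K(𝔣p^∞)/K)` — the currency `IsKatzDistribution₂` of
`DeShalit1987/KatzMeasureFromDistribution.lean` — are:

* §1 **reindexing** along a strictly increasing `ψ : ℕ → ℕ` (`SubgroupTower.reindex`,
  `GroupDistribution.reindex`; same integrals, `integral_reindex`) — to align the levels of `𝒰`
  with the congruence levels `pⁿ` of the coordinates;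
* §2 **the twist `h · μ`** by a bounded tower-continuous function (`GroupDistribution.twist`:
  `(h·μ)_n(a) = ∫ 𝟙_{aU_n} h dμ`, a bounded distribution with bound `‖μ‖ · sup ‖h‖`;
  `integral_twist : ∫ f d(h·μ) = ∫ f·h dμ`) — the measure "`λ̂⁻¹ μ(𝔣)`" of II.4.16, I.3.4 (the
  `𝒪⟦G⟧`-module structure of `Λ(G, 𝒪)`);
* §3 **the push-forward** to a profinite tower `T'` on a metric space (`GroupDistribution.map` along
  level maps `φ_n : G ⧸ U_n → T'.Cell n` compatible with the transitions, e.g. the coordinates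
  `σ ↦ (κ₁σ, κ₂σ) mod pⁿ`; `integral_map : ∫ f d(φ_*μ) = ∫ (f ∘ Φ) dμ` for `Φ` over `φ`) — landing in
  the tree's `BoundedDistribution T' 𝕜` (`PAdicDistributionIntegral.lean`), so that the two-variable
  Amice transform of `PAdicTwoVariableTransformCharacter.lean` applies;
* §4 **tower-continuity from topology**: for a compact topological group, a tower of OPEN subgroups
  with `⋂ U_n ⊆ N` is cofinal among the open sets containing `N`
  (`SubgroupTower.exists_subset_of_isOpen`, Cantor's intersection theorem), whence every continuous
  function that is uniformly left-`N`-invariant — in particular every continuous multiplicative or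
  additive character killing `N` — is tower-continuous (`IsTowerContinuous.of_cofinal`,
  `.of_mul_char`, `.of_add_char`).

Everything is a definition with a body or a theorem; no named facts, no instances, no `sorry`.

## References

* [deShalit1987] E. de Shalit, *Iwasawa theory of elliptic curves with complex multiplication*
  (1987), I.3.1 (p. 15–16: `Λ(G,M)`, measures, the Riemann integral), I.3.4 (p. 18: `Λ(𝒢, 𝒪)` as a
  `ℤ_p⟦𝒢⟧`-module, extension of a measure from `G` to `𝒢 ⊇ G` coset by coset), II.4.16 (49)
  (p. 76), II.4.17 (p. 77–78: reading `μ(𝔣)` on the `ℤ_p`- and `ℤ_p²`-quotients).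
* [MazurTateTeitelbaum1986Invent] B. Mazur, J. Tate, J. Teitelbaum, Invent. Math. 84 (1986), §I.11
  (functoriality of `p`-adic integration).
-/

noncomputable section

open Filter
open scoped Topology Classical

namespace Literature.NumberTheory.EllipticCurves

variable {G : Type*} [Group G]

/-! ### §1. Reindexing a tower along a strictly increasing sequence of levels -/

namespace SubgroupTower

variable (𝒰 : SubgroupTower G)

/-- **The reindexed tower** `n ↦ U (ψ n)` along a monotone `ψ`. [cite: deShalit1987, I.3.1 (p. 15–16)] -/
def reindex (ψ : ℕ → ℕ) (hψ : Monotone ψ) : SubgroupTower G where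
  U n := 𝒰.U (ψ n)
  finiteIndex n := 𝒰.finiteIndex (ψ n)
  succ_le n := 𝒰.le_of_le (hψ n.le_succ)

/-- The levels of the reindexed tower. [cite: deShalit1987, I.3.1 (p. 15–16)] -/
@[simp] theorem reindex_U (ψ : ℕ → ℕ) (hψ : Monotone ψ) (n : ℕ) : (𝒰.reindex ψ hψ).U n = 𝒰.U (ψ n) :=
  rfl

/-- The cells of the reindexed tower are the cells of level `ψ n`. [cite: deShalit1987, I.3.1 (p. 15–16)] -/
theorem reindex_cells (ψ : ℕ → ℕ) (hψ : Monotone ψ) (n : ℕ) :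
    (𝒰.reindex ψ hψ).cells n = 𝒰.cells (ψ n) := rfl

/-- The projections of the reindexed tower. [cite: deShalit1987, I.3.1 (p. 15–16)] -/
theorem reindex_proj (ψ : ℕ → ℕ) (hψ : Monotone ψ) (n : ℕ) (σ : G) :
    (𝒰.reindex ψ hψ).proj n σ = 𝒰.proj (ψ n) σ := rfl

/-- The transition maps of the reindexed tower are the iterated transition maps.
[cite: deShalit1987, I.3.1 (p. 15–16)] -/
theorem reindex_trans (ψ : ℕ → ℕ) (hψ : Monotone ψ) (n : ℕ) (b : G ⧸ 𝒰.U (ψ (n + 1))) :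
    (𝒰.reindex ψ hψ).trans n b = 𝒰.transLE (hψ n.le_succ) b := rfl

variable {𝒰}

/-- Tower-continuity passes to a reindexed tower along an unbounded (strictly increasing) `ψ`.
[cite: deShalit1987, I.3.1 (p. 16)] -/
theorem IsTowerContinuous.reindex {E : Type*} [PseudoMetricSpace E] {f : G → E}
    (hf : 𝒰.IsTowerContinuous f) {ψ : ℕ → ℕ} (hψ : StrictMono ψ) :
    (𝒰.reindex ψ hψ.monotone).IsTowerContinuous f := by
  intro ε hε
  obtain ⟨N, hN⟩ := hf ε hε
  exact ⟨N, fun n hn σ τ h => hN (ψ n) (hn.trans (hψ.id_le n)) σ τ h⟩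

end SubgroupTower

namespace GroupDistribution

variable {𝒰 : SubgroupTower G} {𝕜 : Type*} [NormedField 𝕜] (D : GroupDistribution 𝒰 𝕜)

/-- **The reindexed distribution** `n ↦ μ (ψ n)` on the reindexed tower (its distribution relation is
the iterated relation of `D`). [cite: deShalit1987, I.3.1 (p. 15–16)] -/
def reindex (ψ : ℕ → ℕ) (hψ : Monotone ψ) : GroupDistribution (𝒰.reindex ψ hψ) 𝕜 where
  μ n := D.μ (ψ n)
  sum_fiber n a := by
    have h := D.sum_mul_eq_sum_of_le (hψ n.le_succ) (fun b => if b = a then (1 : 𝕜) else 0)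
    simp only [mul_ite, mul_one, mul_zero, Finset.sum_ite_eq', 𝒰.mem_cells, if_true] at h
    rw [h, ← Finset.sum_filter]
    rfl
  bound := D.bound
  bound_nonneg := D.bound_nonneg
  norm_le n a := D.norm_le (ψ n) a

/-- The level data of the reindexed distribution. [cite: deShalit1987, I.3.1 (p. 15–16)] -/
@[simp] theorem reindex_μ (ψ : ℕ → ℕ) (hψ : Monotone ψ) (n : ℕ) (a : G ⧸ 𝒰.U (ψ n)) :
    (D.reindex ψ hψ).μ n a = D.μ (ψ n) a := rfl

/-- The bound of the reindexed distribution. [cite: deShalit1987, I.3.1 (p. 15–16)] -/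
@[simp] theorem reindex_bound (ψ : ℕ → ℕ) (hψ : Monotone ψ) : (D.reindex ψ hψ).bound = D.bound := rfl

/-- The Riemann sums of the reindexed distribution are a subsequence of those of `D`.
[cite: deShalit1987, I.3.1 (p. 16)] -/
theorem riemannSum_reindex (ψ : ℕ → ℕ) (hψ : Monotone ψ) (f : G → 𝕜) (n : ℕ) :
    (D.reindex ψ hψ).riemannSum f n = D.riemannSum f (ψ n) := rfl

variable [IsUltrametricDist 𝕜] [CompleteSpace 𝕜]

/-- **Reindexing does not change integrals** of tower-continuous functions (a subsequence of a
convergent sequence). [cite: deShalit1987, I.3.1 (p. 16)] -/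
theorem integral_reindex {ψ : ℕ → ℕ} (hψ : StrictMono ψ) {f : G → 𝕜} (hf : 𝒰.IsTowerContinuous f) :
    (D.reindex ψ hψ.monotone).integral f = D.integral f := by
  have h : Tendsto ((D.reindex ψ hψ.monotone).riemannSum f) atTop (𝓝 (D.integral f)) :=
    (D.tendsto_riemannSum_integral hf).comp hψ.tendsto_atTop
  exact h.limUnder_eq

/-! ### §2. The twist `h · μ` of a distribution by a bounded tower-continuous function -/

omit [IsUltrametricDist 𝕜] [CompleteSpace 𝕜] in
/-- The cut-off `𝟙_{aU_n} · h` of a tower-continuous `h` to a cell is tower-continuous.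
[cite: deShalit1987, I.3.1 (p. 16)] -/
theorem _root_.Literature.NumberTheory.EllipticCurves.SubgroupTower.IsTowerContinuous.indicator_mul
    {h : G → 𝕜} (hh : 𝒰.IsTowerContinuous h) {C : ℝ}
    (hC : ∀ σ, ‖h σ‖ ≤ C) (n : ℕ) (a : G ⧸ 𝒰.U n) :
    𝒰.IsTowerContinuous (fun σ => (if 𝒰.proj n σ = a then (1 : 𝕜) else 0) * h σ) := by
  refine SubgroupTower.IsTowerContinuous.mul (M := max 1 C)
    (SubgroupTower.IsTowerContinuous.of_factorsThrough (fun b => if b = a then (1 : 𝕜) else 0)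
      (fun _ => rfl)) hh (fun σ => ?_) (fun σ => (hC σ).trans (le_max_right _ _))
  split_ifs <;> simp

/-- **The twist `h · μ`** of the distribution `D` by a bounded tower-continuous function `h`:
`(h·μ)_n(a) = ∫ 𝟙_{aU_n} h dμ`. For a continuous character `h = λ̂⁻¹` this is de Shalit's measure
`λ̂⁻¹ μ(𝔣)`, whose integrals are `∫ ρ̂⁻¹ d(λ̂⁻¹μ) = ∫ (λρ)^⁻¹ dμ = L_{p,𝔣}(λρ)` (II.4.16 (49)); for
`h` locally constant it is the `𝒪[G/H]`-module structure of `Λ(G, 𝒪)` (I.3.4).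
[cite: deShalit1987, II.4.16 (49) (p. 76), I.3.4 (p. 18)] -/
def twist (h : G → 𝕜) (hh : 𝒰.IsTowerContinuous h) {C : ℝ} (hC0 : 0 ≤ C) (hC : ∀ σ, ‖h σ‖ ≤ C) :
    GroupDistribution 𝒰 𝕜 where
  μ n a := D.integral (fun σ => (if 𝒰.proj n σ = a then (1 : 𝕜) else 0) * h σ)
  sum_fiber n a := by
    rw [← D.integral_finset_sum _ (fun b _ => hh.indicator_mul hC (n + 1) b)]
    refine D.integral_congr fun σ => ?_
    rw [← Finset.sum_mul, ← Finset.sum_filter]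
    congr 1
    by_cases hσ : 𝒰.proj n σ = a
    · rw [if_pos hσ, Finset.sum_eq_single_of_mem (𝒰.proj (n + 1) σ)
        (Finset.mem_filter.mpr ⟨Finset.mem_filter.mpr ⟨𝒰.mem_cells _ _, by rw [𝒰.trans_proj, hσ]⟩,
          rfl⟩) (fun b hb hne => (hne (Finset.mem_filter.mp hb).2.symm).elim)]
    · rw [if_neg hσ]
      refine Finset.sum_eq_zero fun b hb => ?_
      obtain ⟨hb1, hb2⟩ := Finset.mem_filter.mp hb
      exfalso
      apply hσ
      rw [← (Finset.mem_filter.mp hb1).2, ← hb2, 𝒰.trans_proj]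
  bound := D.bound * C
  bound_nonneg := mul_nonneg D.bound_nonneg hC0
  norm_le n a := D.norm_integral_le (hh.indicator_mul hC n a) hC0 fun σ => by
    split_ifs
    · rw [one_mul]; exact hC σ
    · rw [zero_mul, norm_zero]; exact hC0

/-- The level data of the twist: `(h·μ)_n(a) = ∫ 𝟙_{aU_n} h dμ`. [cite: deShalit1987, II.4.16 (49) (p. 76)] -/
theorem twist_μ (h : G → 𝕜) (hh : 𝒰.IsTowerContinuous h) {C : ℝ} (hC0 : 0 ≤ C)
    (hC : ∀ σ, ‖h σ‖ ≤ C) (n : ℕ) (a : G ⧸ 𝒰.U n) :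
    (D.twist h hh hC0 hC).μ n a = D.integral (fun σ => (if 𝒰.proj n σ = a then (1 : 𝕜) else 0) * h σ) :=
  rfl

/-- The bound of the twist is `‖μ‖ · C`. [cite: deShalit1987, II.4.16 (49) (p. 76)] -/
@[simp] theorem twist_bound (h : G → 𝕜) (hh : 𝒰.IsTowerContinuous h) {C : ℝ} (hC0 : 0 ≤ C)
    (hC : ∀ σ, ‖h σ‖ ≤ C) : (D.twist h hh hC0 hC).bound = D.bound * C := rfl

/-- **The cell masses of the twist are close to `μ_n(a) · h(repr a)`**: if `h` varies by at most `δ`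
on the level-`n` cells then `‖(h·μ)_n(a) − μ_n(a) h(x)‖ ≤ ‖μ‖ · δ` for any `x` in the cell `a`.
[cite: deShalit1987, I.3.1 (p. 16)] -/
theorem norm_twist_μ_sub_le (h : G → 𝕜) (hh : 𝒰.IsTowerContinuous h) {C : ℝ} (hC0 : 0 ≤ C)
    (hC : ∀ σ, ‖h σ‖ ≤ C) {n : ℕ} {δ : ℝ} (hδ : 0 ≤ δ)
    (hhδ : ∀ σ τ : G, 𝒰.proj n σ = 𝒰.proj n τ → ‖h σ - h τ‖ ≤ δ) (a : G ⧸ 𝒰.U n) {x : G}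
    (hx : 𝒰.proj n x = a) :
    ‖(D.twist h hh hC0 hC).μ n a - D.μ n a * h x‖ ≤ D.bound * δ := by
  have hind : 𝒰.IsTowerContinuous (fun σ => (if 𝒰.proj n σ = a then (1 : 𝕜) else 0) * h x) :=
    (SubgroupTower.IsTowerContinuous.of_factorsThrough (𝒰 := 𝒰)
      (fun b => if b = a then (1 : 𝕜) else 0) (fun _ => rfl)).mul
      (SubgroupTower.IsTowerContinuous.const (h x)) (M := max 1 C)
      (fun σ => by split_ifs <;> simp) (fun _ => (hC x).trans (le_max_right _ _))
  have hcell : D.μ n a * h x = D.integral (fun σ => (if 𝒰.proj n σ = a then (1 : 𝕜) else 0) * h x) := by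
    rw [D.integral_eq_sum_of_factorsThrough (m := n) (fun b => (if b = a then (1 : 𝕜) else 0) * h x)
      (fun _ => rfl)]
    simp [Finset.sum_ite_eq', 𝒰.mem_cells, ite_mul]
  rw [twist_μ, hcell, ← D.integral_sub (hh.indicator_mul hC n a) hind]
  refine D.norm_integral_le ((hh.indicator_mul hC n a).sub hind) hδ fun σ => ?_
  rw [← mul_sub]
  split_ifs with hσ
  · rw [one_mul]; exact hhδ σ x (hσ.trans hx.symm)
  · rw [zero_mul, norm_zero]; exact hδ

/-- **Integration against the twist: `∫ f d(h·μ) = ∫ f·h dμ`** for `f` bounded and tower-continuous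
(de Shalit II.4.16: `∫ ρ̂⁻¹ d(λ̂⁻¹ μ) = ∫ (λρ)^⁻¹ dμ`). [cite: deShalit1987, II.4.16 (49) (p. 76), I.3.1 (p. 16)] -/
theorem integral_twist (h : G → 𝕜) (hh : 𝒰.IsTowerContinuous h) {C : ℝ} (hC0 : 0 ≤ C)
    (hC : ∀ σ, ‖h σ‖ ≤ C) {f : G → 𝕜} (hf : 𝒰.IsTowerContinuous f) {M : ℝ} (hM : ∀ σ, ‖f σ‖ ≤ M) :
    (D.twist h hh hC0 hC).integral f = D.integral (fun σ => f σ * h σ) := by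
  have hM0 : 0 ≤ M := (norm_nonneg _).trans (hM 1)
  have hfh : 𝒰.IsTowerContinuous (fun σ => f σ * h σ) :=
    hf.mul hh (M := max M C) (fun σ => (hM σ).trans (le_max_left _ _))
      (fun σ => (hC σ).trans (le_max_right _ _))
  have h1 : Tendsto ((D.twist h hh hC0 hC).riemannSum f) atTop (𝓝 ((D.twist h hh hC0 hC).integral f)) :=
    (D.twist h hh hC0 hC).tendsto_riemannSum_integral hf
  have h2 : Tendsto (D.riemannSum (fun σ => f σ * h σ)) atTop (𝓝 (D.integral (fun σ => f σ * h σ))) :=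
    D.tendsto_riemannSum_integral hfh
  -- the two Riemann sums differ by at most `M · ‖μ‖ · osc_n(h) → 0`
  have h0 : Tendsto (fun n => (D.twist h hh hC0 hC).riemannSum f n - D.riemannSum (fun σ => f σ * h σ) n)
      atTop (𝓝 0) := by
    refine Metric.tendsto_atTop.mpr fun ε hε => ?_
    have hb : 0 < (M + 1) * (D.bound + 1) := by
      have := D.bound_nonneg; positivity
    obtain ⟨N, hN⟩ := hh.exists_forall_norm_sub_le (div_pos hε hb)
    refine ⟨N, fun n hn => ?_⟩
    rw [dist_zero_right, riemannSum_def, riemannSum_def, ← Finset.sum_sub_distrib]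
    calc ‖∑ a ∈ 𝒰.cells n, ((D.twist h hh hC0 hC).μ n a * f (𝒰.repr n a) -
            D.μ n a * (f (𝒰.repr n a) * h (𝒰.repr n a)))‖
        ≤ M * (D.bound * (ε / ((M + 1) * (D.bound + 1)))) := by
          refine IsUltrametricDist.norm_sum_le_of_forall_le_of_nonneg
            (mul_nonneg hM0 (mul_nonneg D.bound_nonneg (div_pos hε hb).le)) fun a _ => ?_
          have hrew : (D.twist h hh hC0 hC).μ n a * f (𝒰.repr n a) -
              D.μ n a * (f (𝒰.repr n a) * h (𝒰.repr n a)) =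
              f (𝒰.repr n a) * ((D.twist h hh hC0 hC).μ n a - D.μ n a * h (𝒰.repr n a)) := by ring
          rw [hrew, norm_mul]
          exact mul_le_mul (hM _) (D.norm_twist_μ_sub_le h hh hC0 hC (div_pos hε hb).le (hN n hn) a
            (𝒰.proj_repr n a)) (norm_nonneg _) hM0
      _ < ε := by
          rw [← mul_assoc, mul_div_assoc', div_lt_iff₀ hb]
          have := D.bound_nonneg
          nlinarith [mul_nonneg hM0 D.bound_nonneg]
  have h3 := h0.add h2
  simp only [sub_add_cancel, zero_add] at h3
  exact tendsto_nhds_unique h1 h3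

/-! ### §3. Push-forward to a profinite tower on a metric space -/

variable {X' : Type*} [PseudoMetricSpace X'] {T' : ProfiniteTower X'}

omit [CompleteSpace 𝕜] in
/-- **The push-forward `φ_* μ`** of a group distribution along level maps
`φ_n : G ⧸ U_n → T'.Cell n` compatible with the transition maps (`φ_n ∘ trans = trans' ∘ φ_{n+1}`):
`(φ_* μ)_n(a') = Σ_{φ_n a = a'} μ_n(a)`, a bounded distribution on `T'` with the same bound — e.g. the
coordinates `σ ↦ (κ₁σ, κ₂σ) mod pⁿ` of a `ℤ_p²`-quotient, de Shalit II.4.17.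
[cite: deShalit1987, II.4.17 (p. 77–78)] [cite: MazurTateTeitelbaum1986Invent, §I.11] -/
def map (φ : (n : ℕ) → G ⧸ 𝒰.U n → T'.Cell n)
    (hφ : ∀ (n : ℕ) (b : G ⧸ 𝒰.U (n + 1)), φ n (𝒰.trans n b) = T'.trans n (φ (n + 1) b)) :
    BoundedDistribution T' 𝕜 where
  μ n a' := ∑ a ∈ (𝒰.cells n).filter (fun a => φ n a = a'), D.μ n a
  sum_fiber n a' := by
    rw [Finset.sum_fiberwise_eq_sum_filter]
    have h1 : (Finset.univ.filter fun b' : T'.Cell (n + 1) => T'.trans n b' = a') =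
        Finset.univ.filter fun b' : T'.Cell (n + 1) => T'.trans n b' = a' := rfl
    have h2 : ((𝒰.cells (n + 1)).filter fun b =>
        φ (n + 1) b ∈ Finset.univ.filter fun b' : T'.Cell (n + 1) => T'.trans n b' = a') =
        (𝒰.cells (n + 1)).filter fun b =>
          𝒰.trans n b ∈ (𝒰.cells n).filter fun a => φ n a = a' := by
      ext b
      simp only [Finset.mem_filter, Finset.mem_univ, true_and, 𝒰.mem_cells, hφ]
    rw [h2, ← Finset.sum_fiberwise_eq_sum_filter]
    exact Finset.sum_congr rfl fun a _ => D.sum_fiber n a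
  bound := D.bound
  bound_nonneg := D.bound_nonneg
  norm_le n a' := IsUltrametricDist.norm_sum_le_of_forall_le_of_nonneg D.bound_nonneg
    fun a _ => D.norm_le n a

omit [CompleteSpace 𝕜] in
/-- The level data of the push-forward. [cite: MazurTateTeitelbaum1986Invent, §I.11] -/
@[simp] theorem map_μ (φ : (n : ℕ) → G ⧸ 𝒰.U n → T'.Cell n) (hφ) (n : ℕ) (a' : T'.Cell n) :
    (D.map φ hφ).μ n a' = ∑ a ∈ (𝒰.cells n).filter (fun a => φ n a = a'), D.μ n a := rfl

omit [CompleteSpace 𝕜] in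
/-- The bound of the push-forward is that of `D`. [cite: MazurTateTeitelbaum1986Invent, §I.11] -/
@[simp] theorem map_bound (φ : (n : ℕ) → G ⧸ 𝒰.U n → T'.Cell n) (hφ) : (D.map φ hφ).bound = D.bound :=
  rfl

omit [CompleteSpace 𝕜] in
/-- **Riemann sums of the push-forward**: `RS(φ_* μ, f, n) = Σ_a μ_n(a) · f(repr' (φ_n a))`.
[cite: MazurTateTeitelbaum1986Invent, §I.11] -/
theorem riemannSum_map (φ : (n : ℕ) → G ⧸ 𝒰.U n → T'.Cell n) (hφ) (f : X' → 𝕜) (n : ℕ) :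
    (D.map φ hφ).riemannSum f n = ∑ a ∈ 𝒰.cells n, D.μ n a * f (T'.repr n (φ n a)) := by
  rw [BoundedDistribution.riemannSum_def]
  simp only [map_μ, Finset.sum_mul]
  rw [← Finset.sum_fiberwise_of_maps_to (s := 𝒰.cells n) (t := (Finset.univ : Finset (T'.Cell n)))
    (g := φ n) (fun _ _ => Finset.mem_univ _)]
  refine Finset.sum_congr rfl fun a' _ => Finset.sum_congr rfl fun a ha => ?_
  rw [(Finset.mem_filter.mp ha).2]

omit [CompleteSpace 𝕜] in
/-- **The Riemann sums of `φ_* μ` for `f` and of `μ` for `f ∘ Φ` differ by at most `‖μ‖ · δ`** when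
`Φ : G → X'` lies over `φ` and `f` varies by at most `δ` on the level-`n` cells of `T'`.
[cite: MazurTateTeitelbaum1986Invent, §I.11] -/
theorem norm_riemannSum_map_sub_le (φ : (n : ℕ) → G ⧸ 𝒰.U n → T'.Cell n) (hφ) {Φ : G → X'}
    (hΦ : ∀ (n : ℕ) (σ : G), T'.proj n (Φ σ) = φ n (𝒰.proj n σ)) {f : X' → 𝕜} {δ : ℝ} (hδ : 0 ≤ δ)
    {n : ℕ} (hf : ∀ x y : X', T'.proj n x = T'.proj n y → ‖f x - f y‖ ≤ δ) :
    ‖(D.map φ hφ).riemannSum f n - D.riemannSum (f ∘ Φ) n‖ ≤ D.bound * δ := by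
  rw [riemannSum_map, riemannSum_def, ← Finset.sum_sub_distrib]
  refine IsUltrametricDist.norm_sum_le_of_forall_le_of_nonneg (mul_nonneg D.bound_nonneg hδ)
    fun a _ => ?_
  rw [Function.comp_apply, ← mul_sub, norm_mul]
  refine mul_le_mul (D.norm_le n a) (hf _ _ ?_) (norm_nonneg _) D.bound_nonneg
  rw [T'.proj_repr, hΦ, 𝒰.proj_repr]

omit [IsUltrametricDist 𝕜] [CompleteSpace 𝕜] in
/-- A uniformly continuous function on `X'` pulled back along a map `Φ` lying over level maps is
tower-continuous. [cite: MazurTateTeitelbaum1986Invent, §I.11] -/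
theorem _root_.Literature.NumberTheory.EllipticCurves.SubgroupTower.isTowerContinuous_comp_of_over
    (𝒰 : SubgroupTower G) (φ : (n : ℕ) → G ⧸ 𝒰.U n → T'.Cell n) {Φ : G → X'}
    (hΦ : ∀ (n : ℕ) (σ : G), T'.proj n (Φ σ) = φ n (𝒰.proj n σ)) {E : Type*} [PseudoMetricSpace E]
    {f : X' → E} (hf : UniformContinuous f) : 𝒰.IsTowerContinuous (f ∘ Φ) := by
  intro ε hε
  obtain ⟨η, hη, h⟩ := Metric.uniformContinuous_iff.mp hf ε hε
  obtain ⟨N, hN⟩ := T'.exists_forall_dist_lt η hη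
  refine ⟨N, fun n hn σ τ hστ => h (hN n hn _ _ ?_)⟩
  rw [hΦ, hΦ, hστ]

/-- **Change of variables**: `∫ f d(φ_* μ) = ∫ (f ∘ Φ) dμ` for `Φ : G → X'` lying over `φ` and `f`
uniformly continuous — de Shalit II.4.17: an integral over `𝒢(𝔣)` of a function of the coordinates
`(κ₁σ, κ₂σ)` is an integral over `ℤ_p²`. [cite: deShalit1987, II.4.17 (p. 77–78)]
[cite: MazurTateTeitelbaum1986Invent, §I.11] -/
theorem integral_map (φ : (n : ℕ) → G ⧸ 𝒰.U n → T'.Cell n) (hφ) {Φ : G → X'}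
    (hΦ : ∀ (n : ℕ) (σ : G), T'.proj n (Φ σ) = φ n (𝒰.proj n σ)) {f : X' → 𝕜}
    (hf : UniformContinuous f) : (D.map φ hφ).integral f = D.integral (f ∘ Φ) := by
  have h1 : Tendsto ((D.map φ hφ).riemannSum f) atTop (𝓝 ((D.map φ hφ).integral f)) :=
    (D.map φ hφ).tendsto_riemannSum_integral hf
  have h2 : Tendsto (D.riemannSum (f ∘ Φ)) atTop (𝓝 (D.integral (f ∘ Φ))) :=
    D.tendsto_riemannSum_integral (𝒰.isTowerContinuous_comp_of_over φ hΦ hf)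
  have h0 : Tendsto (fun n => (D.map φ hφ).riemannSum f n - D.riemannSum (f ∘ Φ) n) atTop (𝓝 0) := by
    refine Metric.tendsto_atTop.mpr fun ε hε => ?_
    have hb : 0 < D.bound + 1 := by linarith [D.bound_nonneg]
    obtain ⟨N, hN⟩ := T'.exists_forall_norm_sub_le hf (div_pos hε hb)
    refine ⟨N, fun n hn => ?_⟩
    rw [dist_zero_right]
    calc ‖(D.map φ hφ).riemannSum f n - D.riemannSum (f ∘ Φ) n‖
        ≤ D.bound * (ε / (D.bound + 1)) :=
          D.norm_riemannSum_map_sub_le φ hφ hΦ (div_pos hε hb).le (hN n hn)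
      _ < ε := by
          rw [mul_div_assoc', div_lt_iff₀ hb]
          nlinarith [D.bound_nonneg]
  have h3 := h0.add h2
  simp only [sub_add_cancel, zero_add] at h3
  exact tendsto_nhds_unique h1 h3

omit [CompleteSpace 𝕜] in
/-- Push-forward preserves the sums of level data over all cells (total mass).
[cite: MazurTateTeitelbaum1986Invent, §I.11] -/
theorem sum_map_μ (φ : (n : ℕ) → G ⧸ 𝒰.U n → T'.Cell n) (hφ) (n : ℕ) :
    ∑ a' : T'.Cell n, (D.map φ hφ).μ n a' = ∑ a ∈ 𝒰.cells n, D.μ n a := by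
  simp only [map_μ]
  exact Finset.sum_fiberwise_of_maps_to (fun _ _ => Finset.mem_univ _) _

end GroupDistribution

/-! ### §4. Tower-continuity from topology: cofinal towers of open subgroups of a compact group -/

namespace SubgroupTower

/-- The **kernel subgroup `{σ | f σ = 1}` of a multiplicative function** `f : G → 𝕜` with
`f 1 = 1` (a normal subgroup, the codomain being commutative). [folklore] -/
def mulCharKer {𝕜 : Type*} [Field 𝕜] (f : G → 𝕜) (hmul : ∀ σ τ, f (σ * τ) = f σ * f τ)
    (h1 : f 1 = 1) : Subgroup G where
  carrier := {σ | f σ = 1}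
  mul_mem' {a b} ha hb := by
    simp only [Set.mem_setOf_eq] at ha hb ⊢
    rw [hmul, ha, hb, one_mul]
  one_mem' := h1
  inv_mem' {a} ha := by
    simp only [Set.mem_setOf_eq] at ha ⊢
    have h := hmul a⁻¹ a
    rw [inv_mul_cancel, h1, ha, mul_one] at h
    exact h.symm

/-- Membership in `mulCharKer`. [folklore] -/
private theorem mem_mulCharKer {𝕜 : Type*} [Field 𝕜] {f : G → 𝕜} {hmul : ∀ σ τ, f (σ * τ) = f σ * f τ}
    {h1 : f 1 = 1} {σ : G} : σ ∈ mulCharKer f hmul h1 ↔ f σ = 1 := Iff.rfl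

/-- The kernel of a multiplicative function into a (commutative) field is normal. [folklore] -/
private theorem mulCharKer_normal {𝕜 : Type*} [Field 𝕜] (f : G → 𝕜) (hmul : ∀ σ τ, f (σ * τ) = f σ * f τ)
    (h1 : f 1 = 1) : (mulCharKer f hmul h1).Normal := by
  refine ⟨fun σ hσ g => ?_⟩
  rw [mem_mulCharKer] at hσ ⊢
  have hg : f g * f g⁻¹ = 1 := by rw [← hmul, mul_inv_cancel, h1]
  rw [hmul, hmul, hσ, mul_one, hg]

/-- The **kernel subgroup `{σ | f σ = 0}` of an additive function** `f : G → E` into an additive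
commutative group (normal). [folklore] -/
def addCharKer {E : Type*} [AddCommGroup E] (f : G → E) (hadd : ∀ σ τ, f (σ * τ) = f σ + f τ) :
    Subgroup G where
  carrier := {σ | f σ = 0}
  mul_mem' {a b} ha hb := by
    simp only [Set.mem_setOf_eq] at ha hb ⊢
    rw [hadd, ha, hb, zero_add]
  one_mem' := by
    have h := hadd 1 1
    rw [mul_one] at h
    simpa using h
  inv_mem' {a} ha := by
    simp only [Set.mem_setOf_eq] at ha ⊢
    have h1 : f 1 = 0 := by have h := hadd 1 1; rw [mul_one] at h; simpa using h
    have h := hadd a⁻¹ a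
    rw [inv_mul_cancel, h1, ha, add_zero] at h
    exact h.symm

/-- Membership in `addCharKer`. [folklore] -/
private theorem mem_addCharKer {E : Type*} [AddCommGroup E] {f : G → E} {hadd : ∀ σ τ, f (σ * τ) = f σ + f τ}
    {σ : G} : σ ∈ addCharKer f hadd ↔ f σ = 0 := Iff.rfl

/-- The kernel of an additive function into a commutative group is normal. [folklore] -/
private theorem addCharKer_normal {E : Type*} [AddCommGroup E] (f : G → E)
    (hadd : ∀ σ τ, f (σ * τ) = f σ + f τ) : (addCharKer f hadd).Normal := by
  refine ⟨fun σ hσ g => ?_⟩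
  rw [mem_addCharKer] at hσ ⊢
  have h1 : f 1 = 0 := by have h := hadd 1 1; rw [mul_one] at h; simpa using h
  have hg : f g + f g⁻¹ = 0 := by rw [← hadd, mul_inv_cancel, h1]
  rw [hadd, hadd, hσ, add_zero, hg]

variable [TopologicalSpace G] (𝒰 : SubgroupTower G)

/-- **A tower of open subgroups of a compact group with `⋂ U_n ⊆ N` is cofinal among the open sets
containing `N`**: every open `W ⊇ N` contains some `U_n` (Cantor's intersection theorem for the
closed sets `U_n ∖ W` in the compact space `G`; open subgroups are closed).
[cite: deShalit1987, I.3.1 (p. 16)] -/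
theorem exists_subset_of_isOpen [SeparatelyContinuousMul G] [CompactSpace G]
    (hU : ∀ n, IsOpen (𝒰.U n : Set G)) {N : Set G} (hN : ⋂ n, (𝒰.U n : Set G) ⊆ N)
    {W : Set G} (hW : IsOpen W) (hNW : N ⊆ W) : ∃ n, (𝒰.U n : Set G) ⊆ W := by
  have hs : IsCompact Wᶜ := hW.isClosed_compl.isCompact
  have hdir : Directed (· ⊇ ·) (fun n => (𝒰.U n : Set G)) :=
    Antitone.directed_ge fun m n hmn => SetLike.coe_subset_coe.mpr (𝒰.le_of_le hmn)
  obtain ⟨n, hn⟩ := hs.elim_directed_family_closed (fun n => (𝒰.U n : Set G))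
    (fun n => (𝒰.U n).isClosed_of_isOpen (hU n))
    (Set.eq_empty_of_subset_empty fun x ⟨hxW, hxU⟩ => hxW (hNW (hN hxU))) hdir
  exact ⟨n, fun x hx => by_contra fun hxW => (Set.eq_empty_iff_forall_notMem.mp hn) x ⟨hxW, hx⟩⟩

variable {𝒰}

/-- **Tower-continuity from a cofinality hypothesis**: if for every `ε` there is an open set
`W ⊇ N` with `dist (f σ) (f τ) < ε` whenever `σ⁻¹τ ∈ W` (uniform continuity in the left
uniformity, "modulo `N`"), and the tower of open subgroups satisfies `⋂ U_n ⊆ N` in a compact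
group, then `f` is tower-continuous. [cite: deShalit1987, I.3.1 (p. 16)] -/
theorem IsTowerContinuous.of_cofinal [SeparatelyContinuousMul G] [CompactSpace G]
    (hU : ∀ n, IsOpen (𝒰.U n : Set G)) {N : Set G} (hN : ⋂ n, (𝒰.U n : Set G) ⊆ N)
    {E : Type*} [PseudoMetricSpace E] {f : G → E}
    (hf : ∀ ε : ℝ, 0 < ε → ∃ W : Set G, IsOpen W ∧ N ⊆ W ∧ ∀ σ τ : G, σ⁻¹ * τ ∈ W →
      dist (f σ) (f τ) < ε) :
    𝒰.IsTowerContinuous f := by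
  intro ε hε
  obtain ⟨W, hW, hNW, hfW⟩ := hf ε hε
  obtain ⟨n, hn⟩ := 𝒰.exists_subset_of_isOpen hU hN hW hNW
  exact ⟨n, fun m hm σ τ h => hfW σ τ (hn (𝒰.le_of_le hm (𝒰.proj_eq_iff.mp h)))⟩

/-- **A continuous multiplicative character of norm `≤ 1` killing `N` is tower-continuous** for any
compact-group tower of open subgroups with `⋂ U_n ⊆ N` (the case of the `p`-adic avatars
`ε̂ : Γ_K → 𝒪_{ℂ_p}` integrated in de Shalit II.4.16 (49)). [cite: deShalit1987, II.4.16 (49) (p. 76)] -/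
theorem IsTowerContinuous.of_mul_char [SeparatelyContinuousMul G] [CompactSpace G]
    (hU : ∀ n, IsOpen (𝒰.U n : Set G)) {N : Set G} (hN : ⋂ n, (𝒰.U n : Set G) ⊆ N)
    {𝕜 : Type*} [NormedField 𝕜] {f : G → 𝕜} (hcont : Continuous f)
    (hmul : ∀ σ τ, f (σ * τ) = f σ * f τ) (hone : ∀ σ, ‖f σ‖ ≤ 1) (hker : ∀ ν ∈ N, f ν = 1) :
    𝒰.IsTowerContinuous f := by
  refine IsTowerContinuous.of_cofinal hU hN fun ε hε => ⟨{τ | dist (f τ) 1 < ε},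
    isOpen_lt (hcont.dist continuous_const) continuous_const, fun ν hν => by
      simp [hker ν hν, hε], fun σ τ hστ => ?_⟩
  have hτ : f τ = f σ * f (σ⁻¹ * τ) := by rw [← hmul, mul_inv_cancel_left]
  have hu : dist (f (σ⁻¹ * τ)) 1 < ε := hστ
  calc dist (f σ) (f τ) = ‖f σ * (1 - f (σ⁻¹ * τ))‖ := by rw [dist_eq_norm, hτ, mul_sub, mul_one]
    _ = ‖f σ‖ * ‖1 - f (σ⁻¹ * τ)‖ := norm_mul _ _
    _ ≤ 1 * ‖1 - f (σ⁻¹ * τ)‖ := by gcongr; exact hone σ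
    _ < ε := by rwa [one_mul, ← dist_eq_norm, dist_comm]

/-- **A continuous additive character killing `N` is tower-continuous** for any compact-group tower
of open subgroups with `⋂ U_n ⊆ N` (the case of the coordinates `κ_i : Γ_K → ℤ_p` of the
`ℤ_p²`-tower, de Shalit II.4.17). [cite: deShalit1987, II.4.17 (p. 77–78)] -/
theorem IsTowerContinuous.of_add_char [SeparatelyContinuousMul G] [CompactSpace G]
    (hU : ∀ n, IsOpen (𝒰.U n : Set G)) {N : Set G} (hN : ⋂ n, (𝒰.U n : Set G) ⊆ N)
    {E : Type*} [SeminormedAddCommGroup E] {f : G → E} (hcont : Continuous f)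
    (hadd : ∀ σ τ, f (σ * τ) = f σ + f τ) (hker : ∀ ν ∈ N, f ν = 0) :
    𝒰.IsTowerContinuous f := by
  refine IsTowerContinuous.of_cofinal hU hN fun ε hε => ⟨{τ | ‖f τ‖ < ε},
    isOpen_lt (continuous_norm.comp hcont) continuous_const, fun ν hν => by
      simp [hker ν hν, hε], fun σ τ hστ => ?_⟩
  have hτ : f τ = f σ + f (σ⁻¹ * τ) := by rw [← hadd, mul_inv_cancel_left]
  have hu : ‖f (σ⁻¹ * τ)‖ < ε := hστ
  rwa [dist_eq_norm, hτ, sub_add_cancel_left, norm_neg]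

/-- **A continuous multiplicative character of norm `≤ 1` killing a set `𝒮` of generators is
tower-continuous** for any compact-group tower of open subgroups with
`⋂ U_n ⊆ closure (normal closure of 𝒮)` — the shape in which Galois-side kernels are presented
(`Gal(K̄/M)` = the closed normal subgroup generated by commutators and inertia groups).
[cite: deShalit1987, II.4.16 (49) (p. 76)] -/
theorem IsTowerContinuous.of_mul_char_of_generators [IsTopologicalGroup G] [CompactSpace G]
    (hU : ∀ n, IsOpen (𝒰.U n : Set G)) {𝒮 : Set G}
    (hN : ⋂ n, (𝒰.U n : Set G) ⊆ ((Subgroup.normalClosure 𝒮).topologicalClosure : Set G))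
    {𝕜 : Type*} [NormedField 𝕜] {f : G → 𝕜} (hcont : Continuous f)
    (hmul : ∀ σ τ, f (σ * τ) = f σ * f τ) (h1 : f 1 = 1) (hone : ∀ σ, ‖f σ‖ ≤ 1)
    (h𝒮 : ∀ s ∈ 𝒮, f s = 1) : 𝒰.IsTowerContinuous f := by
  haveI := mulCharKer_normal f hmul h1
  have hle : (Subgroup.normalClosure 𝒮).topologicalClosure ≤ mulCharKer f hmul h1 :=
    Subgroup.topologicalClosure_minimal _ (Subgroup.normalClosure_le_normal fun s hs => h𝒮 s hs)
      (isClosed_eq hcont continuous_const)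
  exact IsTowerContinuous.of_mul_char hU hN hcont hmul hone fun ν hν => hle hν

/-- **A continuous additive character killing a set `𝒮` of generators is tower-continuous** for
any compact-group tower of open subgroups with `⋂ U_n ⊆ closure (normal closure of 𝒮)` (the case of
the coordinates `κ_i : Γ_K → ℤ_p`, which kill commutators and — `ℤ_p`-extensions being unramified
outside `p` — the inertia groups away from `p`). [cite: deShalit1987, II.4.17 (p. 77–78)] -/
theorem IsTowerContinuous.of_add_char_of_generators [IsTopologicalGroup G] [CompactSpace G]
    (hU : ∀ n, IsOpen (𝒰.U n : Set G)) {𝒮 : Set G}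
    (hN : ⋂ n, (𝒰.U n : Set G) ⊆ ((Subgroup.normalClosure 𝒮).topologicalClosure : Set G))
    {E : Type*} [NormedAddCommGroup E] {f : G → E} (hcont : Continuous f)
    (hadd : ∀ σ τ, f (σ * τ) = f σ + f τ) (h𝒮 : ∀ s ∈ 𝒮, f s = 0) : 𝒰.IsTowerContinuous f := by
  haveI := addCharKer_normal f hadd
  have hle : (Subgroup.normalClosure 𝒮).topologicalClosure ≤ addCharKer f hadd :=
    Subgroup.topologicalClosure_minimal _ (Subgroup.normalClosure_le_normal fun s hs => h𝒮 s hs)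
      (isClosed_eq hcont continuous_const)
  exact IsTowerContinuous.of_add_char hU hN hcont hadd fun ν hν => hle hν

end SubgroupTower

end Literature.NumberTheory.EllipticCurves

end
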